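import Mathlib
import HarnessLib
import Summits.HubbardSuperconductivity.HubbardSuperconductivity.Theorems.KLProgrammeKLRegimeEngineTowerRemeasureLev
import Summits.HubbardSuperconductivity.HubbardSuperconductivity.Theorems.KLProgrammeKLRegimeWickCrossContractionNorms

/-!
# Route `KLProgramme` — crux K3 ENGINE (stmt-HubbardSuperconductivity-20437 `KLRegimeEngineV17F2`), stub (b) v2, THE LEVELS PACKAGE (ℓ):
# instantiation (I1), THE LEVELLED-CURRENCY BRIDGE — E1's carrier `klLevNormOf` ↔ the prescribed doors' `(E, τ)` / `(J ⊂ legs, τ″)` filter forms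
# (E1-LEVELS-BLUEPRINT-g8 §8 last sentence «What remains of (I1): … the levelled-currency bridge»; cell gate-hubbard-kl, seat hubbard-kl-k3c2-p3 g10)

The prescribed (Hstep) doors (`Literature/…/SectorisedIncrementBoundGradedPrescribedPlateau`, `…BinomialPrescribedPlateau`; at the block geometry
`…EngineTowerBlockStepLev.blockStep_ordersGe2_lev_le` / `blockStep_firstOrder_lev_le`) read their INPUT sizes in the `(E, τ)`-filter form
  `hB : q ∈ E → E.card = Fc + 1 → ε^m Σ_{σ : σ|_E = τ|_E} Σ_{x : x q = y} ‖W^{F}_σ(G)(x)‖ ≤ B · Fc`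
and conclude in the `X`-tuple form with a prescribed leg set `J ∌ p`:
  `Σ_{X″ : X″ p = w″, (X″ j).2 = τ″ j ∀ j ∈ J} ‖kernel (map (toLin' E(F′)) T′) (m+1) X″‖ ≤ RHS`,
while the tower's levelled data are `klLevNormOf L M β μ K J m T Ωe` (`hubbardSectorKernelNorm` on `prescribedTuples (bgmSectorSet …) Ωe`).  This file is the
two-way dictionary, pure bookkeeping over landed lemmas:

* §1 INPUT side (momentum-conserving `T`): **`doorInput_le_klLevNormOf`** — the `(E, τ)`-filter sum pinned at `q ∈ E` is at most `klLevNormOf … Ωe′` for the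
  prescription `Ωe′ := (τ on E ∖ {q})`, whose level is `E.card − 1` (`levelCount_prescribeOn_erase`); hence **`doorInput_of_levelBounds`** (the doors' `hB` from
  bounds on the levelled norms level by level) and the tower instance **`doorInput_klTowerInput_le_klTowerMeasLev`** (`B (m′+1) Fc := klTowerMeasLev … d k (2m′+2) Fc`).
* §2 OUTPUT side (any `T′`): **`klLevNormOf_le_of_forall_doorSum_le`** — if for every pinned leg `p`, label `s`, point `x` the door-form sum with
  `J := {i ≠ p : Ωe i prescribed}`, `τ″ := (Ωe ·).getD s`, pin `(x, s)`, times `ε^m`, is `≤ C`, then `klLevNormOf … (m+1) T′ Ωe ≤ C`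
  (`pinnedSum_prod_eq_sectorLegSum_prescribed`, `kernel_map_sectorAnalysis`).
Everything is proved; no definitions; nothing about the model is asserted; nothing asserts superconductivity.
References: BGM 2006 §2.8 (2.76), (2.88)–(2.90) [cite: BenfattoGiulianiMastropietro2006].
-/

noncomputable section

namespace Summit.HubbardSuperconductivity.HubbardSuperconductivity.Theorems.EngineV8

set_option linter.dupNamespace false -- summit = problem name (single-conjunct summit), D-0017

open Classical
open Real Finset Literature.MathematicalPhysics.QuantumLattice Literature.Probability.LatticeModels GrassmannAlgebra
open Literature.MathematicalPhysics.QuantumLattice.FermiRG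
open Summit.HubbardSuperconductivity.HubbardSuperconductivity.Theorems.KLRegimeSplit
open Summit.HubbardSuperconductivity.HubbardSuperconductivity.Theorems.KLProgrammeLegKernels
open Summit.HubbardSuperconductivity.HubbardSuperconductivity.Theorems.DispersionFlow
open Summit.HubbardSuperconductivity.HubbardSuperconductivity.Theorems.KLRegimeWick

variable {L M : ℕ} [NeZero L]

/-! ## §1 INPUT side: the doors' `(E, τ)`-filter sums against the levelled carrier -/

section Input

variable {m N : ℕ}

omit [NeZero L] in
/-- The level of the prescription «`τ` on `E ∖ {q}`» is `E.card − 1` (`q ∈ E`). -/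
theorem levelCount_prescribeOn_erase (E : Finset (Fin (m + 1))) (τ : Fin (m + 1) → SectorLeg N) {q : Fin (m + 1)} (hq : q ∈ E) :
    levelCount (fun i => if i ∈ E.erase q then some (τ i) else none) = E.card - 1 := by
  rw [levelCount, ← card_erase_of_mem hq]
  congr 1
  ext i
  simp only [mem_filter, mem_univ, true_and]
  by_cases hi : i ∈ E.erase q <;> simp [hi]

end Input

/-- **THE DOORS' INPUT SUM IS DOMINATED BY THE LEVELLED CARRIER** (momentum-conserving `T`, any thin family `F_J`): for `q ∈ E`,
`ε^m Σ_{σ : σ|_E = τ|_E} Σ_{x : x q = y} ‖W^{F_J}_σ(T)(x)‖ ≤ klLevNormOf … J (m+1) T (τ on E ∖ {q})`. -/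
theorem doorInput_le_klLevNormOf {β : ℝ} (hβ : 0 ≤ β) (μ : ℝ) (K : TrigPolyC4v) (J : ℕ) (T : HubbardGrassmann L M)
    (hT : ∀ (m : ℕ) (X : Fin m → HubbardFieldIdx L M), ∑ i, signedMomentum L (X i).2 (X i).1.1.2 ≠ 0 → kernel ℂ T m X = 0)
    {m : ℕ} (E : Finset (Fin (m + 1))) (τ : Fin (m + 1) → SectorLeg (sectorCount J)) {q : Fin (m + 1)} (hq : q ∈ E) (y : SpaceTimeIdx L M) :
    imagTimeWeight β M ^ m *
        ∑ σ ∈ univ.filter (fun σ : Fin (m + 1) → SectorLeg (sectorCount J) => ∀ e ∈ E, σ e = τ e),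
          ∑ x ∈ univ.filter (fun x : Fin (m + 1) → SpaceTimeIdx L M => x q = y),
            ‖sectorisedKernel L M β (klAnisoFamily L M β μ K klE0 J) T (m + 1) σ x‖ ≤
      klLevNormOf L M β μ K J (m + 1) T (fun i => if i ∈ E.erase q then some (τ i) else none) := by
  have hε0 : 0 ≤ imagTimeWeight β M := imagTimeWeight_nonneg hβ M
  set F := klAnisoFamily L M β μ K klE0 J with hF
  set Ωe' : Fin (m + 1) → Option (SectorLeg (sectorCount J)) := fun i => if i ∈ E.erase q then some (τ i) else none with hΩe'
  rw [klLevNormOf, hubbardSectorKernelNorm_def]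
  refine le_trans ?_ (sectorLegSum_le_sectorisedKernelNorm (imagTimeWeight β M) _ _ q (τ q) y)
  rw [sectorLegSum_def, ← mul_sum]
  refine mul_le_mul_of_nonneg_left ?_ (pow_nonneg hε0 m)
  have hsub : (bgmSectorSet L M F (m + 1)).filter (fun σ : Fin (m + 1) → SectorLeg (sectorCount J) => ∀ e ∈ E, σ e = τ e) ⊆
      univ.filter (fun σ : Fin (m + 1) → SectorLeg (sectorCount J) => ∀ e ∈ E, σ e = τ e) :=
    filter_subset_filter _ (subset_univ _)
  rw [← Finset.sum_subset hsub fun σ hσuniv hσnot => ?_]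
  · refine sum_le_sum_of_subset_of_nonneg ?_ fun _ _ _ => sum_nonneg fun _ _ => norm_nonneg _
    intro σ hσ
    simp only [mem_filter, prescribedTuples] at hσ ⊢
    refine ⟨⟨hσ.1, fun i ℓ hℓ => ?_⟩, hσ.2 q hq⟩
    have hℓ' : (if i ∈ E.erase q then some (τ i) else none) = some ℓ := Option.mem_def.1 hℓ
    split_ifs at hℓ' with hi
    rw [← Option.some.inj hℓ']
    exact hσ.2 i (mem_of_mem_erase hi)
  · have hP := (mem_filter.1 hσuniv).2
    have hnot : σ ∉ bgmSectorSet L M F (m + 1) := fun h => hσnot (mem_filter.2 ⟨h, hP⟩)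
    exact sum_eq_zero fun x _ => by rw [sectorisedKernel_eq_zero_of_not_mem_bgmSectorSet β F T hT hnot x, norm_zero]

/-- **THE DOORS' `hB` FROM LEVEL BOUNDS**: if every prescription of level `Fc` has `klLevNormOf … J (m+1) T Ωe′ ≤ B Fc`, then for every leg set `E ∋ q` with
`E.card = Fc + 1`, prescription `τ` and point `y`: `ε^m Σ_{σ|_E = τ|_E} Σ_{x q = y} ‖W^{F_J}_σ(T)(x)‖ ≤ B Fc` (momentum-conserving `T`). -/
theorem doorInput_of_levelBounds {β : ℝ} (hβ : 0 ≤ β) (μ : ℝ) (K : TrigPolyC4v) (J : ℕ) (T : HubbardGrassmann L M)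
    (hT : ∀ (m : ℕ) (X : Fin m → HubbardFieldIdx L M), ∑ i, signedMomentum L (X i).2 (X i).1.1.2 ≠ 0 → kernel ℂ T m X = 0)
    {m : ℕ} (B : ℕ → ℝ)
    (hB : ∀ Ωe' : Fin (m + 1) → Option (SectorLeg (sectorCount J)), klLevNormOf L M β μ K J (m + 1) T Ωe' ≤ B (levelCount Ωe'))
    (Fc : ℕ) (E : Finset (Fin (m + 1))) (τ : Fin (m + 1) → SectorLeg (sectorCount J)) (q : Fin (m + 1)) (hq : q ∈ E)
    (hE : E.card = Fc + 1) (y : SpaceTimeIdx L M) :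
    imagTimeWeight β M ^ m *
        ∑ σ ∈ univ.filter (fun σ : Fin (m + 1) → SectorLeg (sectorCount J) => ∀ e ∈ E, σ e = τ e),
          ∑ x ∈ univ.filter (fun x : Fin (m + 1) → SpaceTimeIdx L M => x q = y),
            ‖sectorisedKernel L M β (klAnisoFamily L M β μ K klE0 J) T (m + 1) σ x‖ ≤ B Fc := by
  refine (doorInput_le_klLevNormOf hβ μ K J T hT E τ hq y).trans ?_
  have h := hB (fun i => if i ∈ E.erase q then some (τ i) else none)
  rwa [levelCount_prescribeOn_erase E τ hq, hE, Nat.add_sub_cancel] at h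

/-- **TOWER INSTANCE: the block step's `hB` for the input `𝒱_{dk}` at `F_{dk−1}` from the measured levelled sizes** — in the literal shape of
`blockStep_ordersGe2_lev_le`'s / `blockStep_firstOrder_lev_le`'s hypothesis `hB` with `B m Fc := klTowerMeasLev L M β U μ K d k (2m) Fc`
(input family index `J₁ − 1 = dk − 1`). -/
theorem doorInput_klTowerInput_le_klTowerMeasLev [NeZero M] {β : ℝ} (hβ : 0 ≤ β) (U μ : ℝ) (K : TrigPolyC4v) (d k : ℕ)
    (m' Fc : ℕ) (E : Finset (Fin (2 * m' + 1 + 1))) (τ : Fin (2 * m' + 1 + 1) → SectorLeg (sectorCount (d * k - 1)))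
    (q : Fin (2 * m' + 1 + 1)) (hq : q ∈ E) (hE : E.card = Fc + 1) (y : SpaceTimeIdx L M) :
    imagTimeWeight β M ^ (2 * m' + 1) *
        ∑ σ ∈ univ.filter (fun σ : Fin (2 * m' + 1 + 1) → SectorLeg (sectorCount (d * k - 1)) => ∀ e ∈ E, σ e = τ e),
          ∑ x ∈ univ.filter (fun x : Fin (2 * m' + 1 + 1) → SpaceTimeIdx L M => x q = y),
            ‖sectorisedKernel L M β (klAnisoFamily L M β μ K klE0 (d * k - 1)) (klTowerInput L M β U μ K d k) (2 * m' + 1 + 1) σ x‖ ≤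
      klTowerMeasLev L M β U μ K d k (2 * (m' + 1)) Fc := by
  have h2 : 2 * (m' + 1) = 2 * m' + 1 + 1 := by ring
  rw [h2]
  refine doorInput_of_levelBounds hβ μ K (d * k - 1) (klTowerInput L M β U μ K d k)
    (fun m X hX => klEffectiveAction_momentumConserving β U μ K klE0 (d * k) m X hX)
    (fun Fc => klTowerMeasLev L M β U μ K d k (2 * m' + 1 + 1) Fc) (fun Ωe' => ?_) Fc E τ q hq hE y
  exact klLevNormOf_le_klTowerMeasLev β U μ K d k (2 * m' + 1 + 1) Ωe'

/-! ## §2 OUTPUT side: the levelled carrier from the doors' `X`-tuple sums -/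

/-- A leg sum only grows with the constraint set (`0 ≤ ε`). -/
theorem sectorLegSum_mono_set {ε : ℝ} (hε : 0 ≤ ε) {m N : ℕ} {A A' : Finset (Fin (m + 1) → SectorLeg N)} (hA : A ⊆ A')
    (W : (Fin (m + 1) → SectorLeg N) → (Fin (m + 1) → SpaceTimeIdx L M) → ℂ) (p : Fin (m + 1)) (s : SectorLeg N) (x : SpaceTimeIdx L M) :
    sectorLegSum ε A W p s x ≤ sectorLegSum ε A' W p s x := by
  rw [sectorLegSum_def, sectorLegSum_def]
  exact sum_le_sum_of_subset_of_nonneg (filter_subset_filter _ hA)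
    fun _ _ _ => mul_nonneg (pow_nonneg hε m) (sum_nonneg fun _ _ => norm_nonneg _)

omit [NeZero L] in
/-- `prescribedTuples A Ωe ⊆ prescribedTuples univ Ωe`. -/
theorem prescribedTuples_mono_set_univ {m N : ℕ} (A : Finset (Fin m → SectorLeg N)) (Ωe : Fin m → Option (SectorLeg N)) :
    prescribedTuples A Ωe ⊆ prescribedTuples univ Ωe := by
  intro Ω hΩ
  rw [prescribedTuples, mem_filter] at hΩ ⊢
  exact ⟨mem_univ _, hΩ.2⟩

/-- **THE LEVELLED CARRIER FROM THE DOORS' OUTPUT SUMS** (any `T′`, any thin family `F_{J′}`, `0 ≤ β`): if for every pinned leg `p`, label `s` and point `x`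
`ε^m · Σ_{X : X p = (x, s), (X j).2 = (Ωe j).getD s ∀ j ∈ J_p} ‖kernel (map (toLin' E(F_{J′})) T′) (m+1) X‖ ≤ C` with `J_p := {i ≠ p : Ωe i prescribed}` (the doors'
output filter with `p ∉ J_p`), then `klLevNormOf … J′ (m+1) T′ Ωe ≤ C`. -/
theorem klLevNormOf_le_of_forall_doorSum_le {β : ℝ} (hβ : 0 ≤ β) (μ : ℝ) (K : TrigPolyC4v) (J' : ℕ) (T' : HubbardGrassmann L M) {m : ℕ}
    (Ωe : Fin (m + 1) → Option (SectorLeg (sectorCount J'))) {C : ℝ} (hC : 0 ≤ C)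
    (h : ∀ (p : Fin (m + 1)) (s : SectorLeg (sectorCount J')) (x : SpaceTimeIdx L M),
      imagTimeWeight β M ^ m *
        ∑ X ∈ univ.filter (fun X : Fin (m + 1) → SpaceTimeIdx L M × SectorLeg (sectorCount J') =>
            X p = (x, s) ∧ ∀ j ∈ univ.filter (fun i : Fin (m + 1) => (Ωe i).isSome ∧ i ≠ p), (X j).2 = (Ωe j).getD s),
          ‖kernel ℂ (ExteriorAlgebra.map (Matrix.toLin' (sectorAnalysisMatrix L M β (klAnisoFamily L M β μ K klE0 J'))) T') (m + 1) X‖ ≤ C) :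
    klLevNormOf L M β μ K J' (m + 1) T' Ωe ≤ C := by
  have hε0 : 0 ≤ imagTimeWeight β M := imagTimeWeight_nonneg hβ M
  set ε := imagTimeWeight β M with hεdef
  set F' := klAnisoFamily L M β μ K klE0 J' with hF'
  rw [klLevNormOf, hubbardSectorKernelNorm_def]
  refine sectorisedKernelNorm_le_of_forall_le hC fun p s x => ?_
  -- (1) enlarge the constraint set to `prescribedTuples univ Ωe` and pass to the product-label pinned sum
  refine (sectorLegSum_mono_set hε0 (prescribedTuples_mono_set_univ (bgmSectorSet L M F' (m + 1)) Ωe) _ p s x).trans ?_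
  rw [← pinnedSum_prod_eq_sectorLegSum_prescribed ε (sectorisedKernel L M β F' T' (m + 1)) p x s Ωe]
  -- (2) the doors' filter is weaker
  have hsub : (univ.filter fun Y : Fin (m + 1) → SpaceTimeIdx L M × SectorLeg (sectorCount J') =>
        Y p = (x, s) ∧ ∀ i, ∀ t ∈ Ωe i, (Y i).2 = t) ⊆
      univ.filter fun X : Fin (m + 1) → SpaceTimeIdx L M × SectorLeg (sectorCount J') =>
        X p = (x, s) ∧ ∀ j ∈ univ.filter (fun i : Fin (m + 1) => (Ωe i).isSome ∧ i ≠ p), (X j).2 = (Ωe j).getD s := by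
    intro Y hY
    simp only [mem_filter, mem_univ, true_and] at hY ⊢
    refine ⟨hY.1, fun j hj => ?_⟩
    obtain ⟨ℓ, hℓ⟩ := Option.isSome_iff_exists.1 hj.1
    rw [hℓ, Option.getD_some]
    exact hY.2 j ℓ (by simp [hℓ])
  refine le_trans (mul_le_mul_of_nonneg_left (sum_le_sum_of_subset_of_nonneg hsub fun _ _ _ => norm_nonneg _) (pow_nonneg hε0 m)) ?_
  refine le_trans (le_of_eq ?_) (h p s x)
  congr 1
  refine sum_congr rfl fun Y _ => ?_
  rw [kernel_map_sectorAnalysis]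

end Summit.HubbardSuperconductivity.HubbardSuperconductivity.Theorems.EngineV8

end
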